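import Literature.NumberTheory.PAdicHodge.EisensteinRootShortModel
import Literature.NumberTheory.PAdicHodge.AinfRamifiedFormalGroupPoints
import Literature.NumberTheory.EllipticCurves.FormalGroupVerschiebungHasseZeroProofs
import HarnessLib

/-!
# The SUPERSINGULAR SHAPE of `[p]` over the ramified base `𝒪_D = ℤ_p[X]/(X^e − p)`:
# `[p](X) = ϱ·X·Q(X) + X^{p²}·S(X)` with `S(0) ≡ −1 (mod ϱ)` (proofs only)

Topic `Literature/NumberTheory/PAdicHodge`; namespace `Literature.NumberTheory.PAdicHodge`. THEOREMS ONLY (no definition, no named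
fact, no instance, no `sorry`). Companion of `EisensteinRootShortModel` (models `⟨0,0,0,a ϱ^{r₄},b ϱ^{r₆}⟩`, exact height over any
residue field) and `AinfWeierstrassRamifiedTorsionSeparation` (no nonzero `p`-torsion of norm `≤ ‖ϖ‖`); road item (R1) of the `p`-adic
period programme, BSD route EdixhovenFibreFiveSeven, crux K★ `stmt-BirchSwinnertonDyer-22226` (hDR on the potentially supersingular cells).

WHY. Over `ℤ` at good supersingular reduction `[p] = p·X·R + X^{p²}·S` with `R(0), S(0)` units (height `2`: every coefficient
below `X^{p²}` is divisible by `p`). Over `𝒪_D` this is FALSE for curves with potentially (not honestly) good reduction: by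
Katz–Mazur `[X^p][p] ≡ A_p(W) (mod p)` and `A_p` of the K★ cell models is `32a·ϱ^{r₄}` / `192b·ϱ^{r₆}`, divisible by `ϱ^r` but not
by `p = ϱ^e`. What survives is divisibility by `ϱ`: the reduction of `W` modulo `ϱ` is a supersingular curve over `𝔽_p`, whose
`[p]` is `ĩ(X^{p²})`. Hence (this file):

* §1 `EisensteinRoot.exists_ringHom_coeff_zmod` (`𝒪_D → 𝔽_p`, `ϱ ↦ 0`, exists when `D.poly = X^e − p`), `root_not_isUnit`,
  **`mem_span_root_of_map_eq_zero`**: the kernel of ANY `γ : 𝒪_D → 𝔽_p` lies in `(ϱ)` (so `(ϱ) = ker γ` is the maximal ideal);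
* §2 for `W` over `𝒪_D` whose reductions along all `γ : 𝒪_D → 𝔽_p` are supersingular (`A_p = 0`):
  `coeff_formalMul_prime_mem_span_root` (`p² ∤ n ⇒ [X^n][p] ∈ (ϱ)`), and with `Δ(W) ∈ 𝒪_Dˣ`, `p ≥ 5`:
  `coeff_sq_formalMul_prime_add_one_mem_span_root` (`[X^{p²}][p] + 1 ∈ (ϱ)`), packaged as
  **`exists_formalMul_prime_eq_varpi_shape`**: `∃ Q S, [p] = C ϱ·X·Q + X^{p²}·S ∧ S(0) = [X^{p²}][p] ∧ S(0) + 1 ∈ (ϱ)`;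
* §3 the K★ cell models `⟨0,0,0,a ϱ^{r₄}, b ϱ^{r₆}⟩` (`r₄ > 0` at `5`, `r₆ > 0` at `7`, unit `64a³p^{t₄} + 432b²p^{t₆}`) satisfy the
  hypotheses (`formalMul_prime_varpi_shape_model`).

With `AinfRamifiedVarpi` (`A_inf(𝒪)/ϱ` reduced) this gives `[p]T = 0, T ∈ 𝔫_𝒪 ⇒ T ∈ ϱ·A_inf(𝒪) ⇒ ‖θ_𝒪 T‖ ≤ ‖ϖ‖`, and the
separation file finishes `θ_𝒪 T = 0`. BSD is not proved by any of this.

## References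
* [SilvermanAEC2009] J. H. Silverman, *AEC* (2009), IV.4.4, IV.7.5.
* [KatzMazur1985] N. Katz, B. Mazur (1985), 12.4.2.
* [Serre1967GroupesPDivisibles] J.-P. Serre, Sém. Bourbaki 318 (1966/67), §5 Lemme 3 («`aₙ ∈ 𝔪` for `n < p²`»).
-/

noncomputable section

open Polynomial Field ValuativeRel

namespace Literature.NumberTheory.PAdicHodge

open Literature.NumberTheory.GaloisRepresentations
open Literature.NumberTheory.GaloisRepresentations.IsNonarchimedeanLocalField

variable {F : Type} [Field F] [ValuativeRel F] [TopologicalSpace F] [IsNonarchimedeanLocalField F] [CharZero F]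
  {p : ℕ} [Fact p.Prime] {hp : valuation F p < 1} (D : EisensteinRoot F p hp) {e : ℕ}

/-! ## §1 `𝒪_D → 𝔽_p` and `(ϱ) ⊇ ker` -/

namespace EisensteinRoot

/-- **`𝒪_D → 𝔽_p` exists** for `D.poly = X^e − p` (`ℤ_p → 𝔽_p`, `ϱ ↦ 0`; `e ≥ 1`). [cite: SerreLocalFields1979, Ch. I §6 Prop. 18] -/
theorem exists_ringHom_coeff_zmod (hD : D.poly = X ^ e - C (p : ℤ_[p])) : Nonempty (D.Coeff →+* ZMod p) := by
  have he : 0 < e := by have := D.e_pos; rwa [D.e_eq_of_poly_eq hD] at this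
  refine ⟨AdjoinRoot.lift PadicInt.toZMod 0 ?_⟩
  rw [hD, eval₂_sub, eval₂_X_pow, eval₂_C, zero_pow he.ne', map_natCast, ZMod.natCast_self, sub_zero]

/-- **The kernel of any `γ : 𝒪_D → 𝔽_p` lies in `(ϱ)`** (`D.poly = X^e − p`): writing `x = q(ϱ)`, `q = X·q₁ + q₀`, one has
`γ(x) = q̄₀`, so `γ(x) = 0` forces `q₀ ∈ pℤ_p = ϱ^e ℤ_p ⊆ (ϱ)`. [cite: SerreLocalFields1979, Ch. I §6 Prop. 18] -/
theorem mem_span_root_of_map_eq_zero (hD : D.poly = X ^ e - C (p : ℤ_[p])) (γ : D.Coeff →+* ZMod p) {x : D.Coeff}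
    (hx : γ x = 0) : x ∈ Ideal.span {AdjoinRoot.root D.poly} := by
  have he : 0 < e := by have := D.e_pos; rwa [D.e_eq_of_poly_eq hD] at this
  have hroot : AdjoinRoot.root D.poly ^ e = AdjoinRoot.of D.poly p := D.root_pow_eq_of_poly_eq hD
  have hγr : γ (AdjoinRoot.root D.poly) = 0 := map_root_eq_zero_of_pow_eq hroot γ
  obtain ⟨q, rfl⟩ := AdjoinRoot.mk_surjective x
  -- `q = X * divX q + C q₀`
  have hq : AdjoinRoot.mk D.poly q = AdjoinRoot.root D.poly * AdjoinRoot.mk D.poly q.divX + AdjoinRoot.of D.poly (q.coeff 0) := by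
    conv_lhs => rw [← Polynomial.X_mul_divX_add q]
    rw [map_add, map_mul, AdjoinRoot.mk_X, AdjoinRoot.mk_C]
  have h0 : γ (AdjoinRoot.of D.poly (q.coeff 0)) = 0 := by
    have := hx; rw [hq, map_add, map_mul, hγr, zero_mul, zero_add] at this; exact this
  rw [ringHom_of_eq_castHom_toZMod, ZMod.castHom_self, RingHom.id_apply] at h0
  have hmem : q.coeff 0 ∈ RingHom.ker (PadicInt.toZMod (p := p)) := h0
  rw [PadicInt.ker_toZMod, PadicInt.maximalIdeal_eq_span_p, Ideal.mem_span_singleton'] at hmem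
  obtain ⟨c, hc⟩ := hmem
  rw [hq]
  refine Ideal.add_mem _ (Ideal.mul_mem_right _ _ (Ideal.mem_span_singleton_self _)) ?_
  rw [← hc, map_mul, ← hroot]
  exact Ideal.mul_mem_left _ _ (Ideal.pow_mem_of_mem _ (Ideal.mem_span_singleton_self _) _ he)

/-- **`ϱ` is not a unit of `𝒪_D`** (`D.poly = X^e − p`): `γ(ϱ) = 0` in `𝔽_p`. [cite: SerreLocalFields1979, Ch. I §6 Prop. 18] -/
theorem root_not_isUnit (hD : D.poly = X ^ e - C (p : ℤ_[p])) : ¬ IsUnit (AdjoinRoot.root D.poly) := by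
  obtain ⟨γ⟩ := exists_ringHom_coeff_zmod D hD
  intro hu
  have h := hu.map γ
  rw [map_root_eq_zero_of_pow_eq (D.root_pow_eq_of_poly_eq hD) γ] at h
  exact not_isUnit_zero h

end EisensteinRoot

/-! ## §2 The supersingular shape of `[p]` over `𝒪_D` -/

section Shape

variable {D} (W : WeierstrassCurve D.Coeff)

/-- **Serre's hypothesis «`aₙ ∈ (ϱ)` for `p² ∤ n`»**: if every reduction `W ⊗_γ 𝔽_p` (`γ : 𝒪_D → 𝔽_p`) is supersingular, then
`[X^n][p]_W ∈ (ϱ)` for `p² ∤ n` (height `2` of the reduction, tree `coeff_formalMul_prime_eq_zero_of_hasseCoeff_eq_zero`).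
[cite: Serre1967GroupesPDivisibles, §5 Lemme 3] [cite: SilvermanAEC2009, IV.7.5] -/
theorem coeff_formalMul_prime_mem_span_root (hD : D.poly = X ^ e - C (p : ℤ_[p])) (hp2 : p ≠ 2)
    (hA : ∀ γ : D.Coeff →+* ZMod p, (W.map γ).hasseCoeff p = 0) {n : ℕ} (hn : ¬ p ^ 2 ∣ n) :
    PowerSeries.coeff n (W.formalMul p) ∈ Ideal.span {AdjoinRoot.root D.poly} := by
  obtain ⟨γ⟩ := EisensteinRoot.exists_ringHom_coeff_zmod D hD
  refine EisensteinRoot.mem_span_root_of_map_eq_zero D hD γ ?_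
  rw [← PowerSeries.coeff_map, WeierstrassCurve.map_formalMul]
  exact (W.map γ).coeff_formalMul_prime_eq_zero_of_hasseCoeff_eq_zero p hp2 (hA γ) hn

/-- **`[X^{p²}][p]_W ≡ −1 (mod ϱ)`** (EXACT height `2`): if `Δ(W) ∈ 𝒪_Dˣ`, `p ≥ 5` and the reductions are supersingular, then
`[X^{p²}][p]_W + 1 ∈ (ϱ)` (tree `coeff_sq_formalMul_ringChar_of_tr_eq_zero` over `𝔽_p`, Hasse's bound for `a_p = 0`).
[cite: SilvermanAEC2009, IV.7.5 and Ex. V.5.10] -/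
theorem coeff_sq_formalMul_prime_add_one_mem_span_root (hD : D.poly = X ^ e - C (p : ℤ_[p])) (hp5 : 5 ≤ p) (hΔ : IsUnit W.Δ)
    (hA : ∀ γ : D.Coeff →+* ZMod p, (W.map γ).hasseCoeff p = 0) :
    PowerSeries.coeff (p ^ 2) (W.formalMul p) + 1 ∈ Ideal.span {AdjoinRoot.root D.poly} := by
  have hp2 : p ≠ 2 := by omega
  obtain ⟨γ⟩ := EisensteinRoot.exists_ringHom_coeff_zmod D hD
  refine EisensteinRoot.mem_span_root_of_map_eq_zero D hD γ ?_
  haveI : (W.map γ).IsElliptic := ⟨by rw [WeierstrassCurve.map_Δ]; exact hΔ.map γ⟩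
  have htr := Literature.NumberTheory.EllipticCurves.HasseManin.tr_eq_zero_of_dvd_of_five_le (W.map γ) (ZMod.card p) hp5
    (((W.map γ).hasseCoeff_eq_zero_iff_dvd_tr hp2).1 (hA γ))
  rw [map_add, map_one, ← PowerSeries.coeff_map, WeierstrassCurve.map_formalMul,
    (W.map γ).coeff_sq_formalMul_ringChar_of_tr_eq_zero htr, neg_add_cancel]

/-- Coefficients in `(ϱ)` ⇒ the series is `C ϱ · Q`, with `Q(0) = 0` if the constant coefficient vanishes. [folklore] -/
private theorem exists_eq_C_mul {R : Type*} [CommRing R] (ϱ : R) (P : PowerSeries R) (h0 : PowerSeries.constantCoeff P = 0)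
    (h : ∀ n, PowerSeries.coeff n P ∈ Ideal.span {ϱ}) :
    ∃ Q : PowerSeries R, P = PowerSeries.C ϱ * (PowerSeries.X * Q) := by
  have hc : ∀ n, ∃ c : R, PowerSeries.coeff (n + 1) P = ϱ * c := fun n => by
    obtain ⟨c, hc⟩ := Ideal.mem_span_singleton'.1 (h (n + 1)); exact ⟨c, by rw [← hc, mul_comm]⟩
  choose c hc using hc
  refine ⟨PowerSeries.mk c, ?_⟩
  ext n
  rcases n with _ | n
  · rw [PowerSeries.coeff_zero_eq_constantCoeff, h0, ← mul_assoc, map_mul, map_mul, PowerSeries.constantCoeff_X, mul_zero,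
      zero_mul]
  · rw [hc n, ← mul_assoc, mul_comm (PowerSeries.C ϱ), mul_assoc, PowerSeries.coeff_succ_X_mul, PowerSeries.coeff_C_mul,
      PowerSeries.coeff_mk]

/-- **The supersingular shape of `[p]` over `𝒪_D`**: `[p](X) = ϱ·X·Q(X) + X^{p²}·S(X)` with `S(0) = [X^{p²}][p]` and
`S(0) + 1 ∈ (ϱ)`, for `W` over `𝒪_D` (`D.poly = X^e − p`) with `Δ ∈ 𝒪_Dˣ`, `p ≥ 5`, supersingular reductions. (Over `ℤ` one has
`p` in place of `ϱ`; over the ramified base only `ϱ`: `[X^p][p] ≡ A_p (mod p)` need not vanish mod `p`.)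
[cite: Serre1967GroupesPDivisibles, §5 Lemme 3] [cite: SilvermanAEC2009, IV.7.5] -/
theorem exists_formalMul_prime_eq_varpi_shape (hD : D.poly = X ^ e - C (p : ℤ_[p])) (hp5 : 5 ≤ p) (hΔ : IsUnit W.Δ)
    (hA : ∀ γ : D.Coeff →+* ZMod p, (W.map γ).hasseCoeff p = 0) :
    ∃ Q S : PowerSeries D.Coeff,
      W.formalMul p = PowerSeries.C (AdjoinRoot.root D.poly) * PowerSeries.X * Q + PowerSeries.X ^ (p ^ 2) * S ∧
        PowerSeries.constantCoeff S = PowerSeries.coeff (p ^ 2) (W.formalMul p) ∧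
        PowerSeries.constantCoeff S + 1 ∈ Ideal.span {AdjoinRoot.root D.poly} := by
  have hpr : p.Prime := Fact.out
  have hp2 : p ≠ 2 := by omega
  have hp1 : 1 < p ^ 2 := Nat.one_lt_pow two_ne_zero hpr.one_lt
  set S : PowerSeries D.Coeff := PowerSeries.mk fun j => PowerSeries.coeff (j + p ^ 2) (W.formalMul p) with hS
  set P : PowerSeries D.Coeff := PowerSeries.mk fun n => if n < p ^ 2 then PowerSeries.coeff n (W.formalMul p) else 0 with hP
  have hdec : W.formalMul p = P + PowerSeries.X ^ (p ^ 2) * S := by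
    ext n
    rw [map_add, hP, PowerSeries.coeff_mk]
    by_cases hn : n < p ^ 2
    · rw [if_pos hn, PowerSeries.coeff_X_pow_mul', if_neg (not_le.2 hn), add_zero]
    · rw [if_neg hn, zero_add, PowerSeries.coeff_X_pow_mul', if_pos (not_lt.1 hn), hS, PowerSeries.coeff_mk,
        Nat.sub_add_cancel (not_lt.1 hn)]
  have hP0 : PowerSeries.constantCoeff P = 0 := by
    rw [← PowerSeries.coeff_zero_eq_constantCoeff_apply, hP, PowerSeries.coeff_mk, if_pos (by positivity),
      PowerSeries.coeff_zero_eq_constantCoeff_apply, WeierstrassCurve.constantCoeff_formalMul]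
  have hPmem : ∀ n, PowerSeries.coeff n P ∈ Ideal.span {AdjoinRoot.root D.poly} := by
    intro n
    rw [hP, PowerSeries.coeff_mk]
    split_ifs with hn
    · rcases Nat.eq_zero_or_pos n with rfl | hn0
      · rw [PowerSeries.coeff_zero_eq_constantCoeff_apply, WeierstrassCurve.constantCoeff_formalMul]; exact Ideal.zero_mem _
      · exact coeff_formalMul_prime_mem_span_root W hD hp2 hA fun h => absurd (Nat.le_of_dvd hn0 h) (not_le.2 hn)
    · exact Ideal.zero_mem _
  obtain ⟨Q, hQ⟩ := exists_eq_C_mul (AdjoinRoot.root D.poly) P hP0 hPmem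
  refine ⟨Q, S, ?_, ?_, ?_⟩
  · rw [hdec, hQ, mul_assoc]
  · rw [← PowerSeries.coeff_zero_eq_constantCoeff_apply, hS, PowerSeries.coeff_mk, zero_add]
  · rw [← PowerSeries.coeff_zero_eq_constantCoeff_apply, hS, PowerSeries.coeff_mk, zero_add]
    exact coeff_sq_formalMul_prime_add_one_mem_span_root W hD hp5 hΔ hA

end Shape

/-! ## §3 The K★ cell models -/

section Cells

variable {D}

/-- **Supersingular reductions along every `γ : 𝒪_D → 𝔽_p` for the cell models** `⟨0,0,0,a ϱ^{r₄}, b ϱ^{r₆}⟩`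
(`r₄ > 0` if `p = 5`, `r₆ > 0` if `p = 7`). [cite: SilvermanAEC2009, V.4.1 and Ex. V.4.4–4.5] -/
theorem hasseCoeff_map_model_zmod_eq_zero (hD : D.poly = X ^ e - C (p : ℤ_[p])) (hp57 : p = 5 ∨ p = 7) (a b : ℤ_[p])
    {r₄ r₆ : ℕ} (hr₄ : p = 5 → 0 < r₄) (hr₆ : p = 7 → 0 < r₆) (γ : D.Coeff →+* ZMod p) :
    ((⟨0, 0, 0, AdjoinRoot.of D.poly a * AdjoinRoot.root D.poly ^ r₄, AdjoinRoot.of D.poly b * AdjoinRoot.root D.poly ^ r₆⟩ :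
        WeierstrassCurve D.Coeff).map γ).hasseCoeff p = 0 := by
  have hroot := D.root_pow_eq_of_poly_eq hD
  rcases hp57 with rfl | rfl
  · exact hasseCoeff_map_model_five_eq_zero hroot a b (hr₄ rfl) r₆ γ
  · exact hasseCoeff_map_model_seven_eq_zero hroot a b r₄ (hr₆ rfl) γ

/-- **The supersingular shape of `[p]` for the K★ cell models**: `[p] = ϱ·X·Q + X^{p²}·S`, `S(0) = [X^{p²}][p]`, `S(0) + 1 ∈ (ϱ)`,
for `⟨0,0,0,a ϱ^{r₄}, b ϱ^{r₆}⟩` over `𝒪_D = ℤ_p[X]/(X^e − p)`, `p ∈ {5, 7}`, `3r₄ = e t₄`, `2r₆ = e t₆`, unit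
`64a³p^{t₄} + 432b²p^{t₆}`, `r₄ > 0` at `5`, `r₆ > 0` at `7`. [cite: SilvermanAEC2009, IV.7.5] [cite: Serre1967GroupesPDivisibles, §5 Lemme 3] -/
theorem formalMul_prime_varpi_shape_model (hD : D.poly = X ^ e - C (p : ℤ_[p])) (hp57 : p = 5 ∨ p = 7) (a b : ℤ_[p])
    {r₄ r₆ t₄ t₆ : ℕ} (h₄ : 3 * r₄ = e * t₄) (h₆ : 2 * r₆ = e * t₆)
    (hu : IsUnit (64 * a ^ 3 * (p : ℤ_[p]) ^ t₄ + 432 * b ^ 2 * (p : ℤ_[p]) ^ t₆)) (hr₄ : p = 5 → 0 < r₄) (hr₆ : p = 7 → 0 < r₆) :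
    ∃ Q S : PowerSeries D.Coeff,
      (⟨0, 0, 0, AdjoinRoot.of D.poly a * AdjoinRoot.root D.poly ^ r₄, AdjoinRoot.of D.poly b * AdjoinRoot.root D.poly ^ r₆⟩ :
          WeierstrassCurve D.Coeff).formalMul p =
        PowerSeries.C (AdjoinRoot.root D.poly) * PowerSeries.X * Q + PowerSeries.X ^ (p ^ 2) * S ∧
      PowerSeries.constantCoeff S = PowerSeries.coeff (p ^ 2)
        ((⟨0, 0, 0, AdjoinRoot.of D.poly a * AdjoinRoot.root D.poly ^ r₄, AdjoinRoot.of D.poly b * AdjoinRoot.root D.poly ^ r₆⟩ :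
          WeierstrassCurve D.Coeff).formalMul p) ∧
      PowerSeries.constantCoeff S + 1 ∈ Ideal.span {AdjoinRoot.root D.poly} := by
  have hp5 : 5 ≤ p := by rcases hp57 with rfl | rfl <;> norm_num
  exact exists_formalMul_prime_eq_varpi_shape _ hD hp5 (isUnit_Δ_model (D.root_pow_eq_of_poly_eq hD) a b h₄ h₆ hu)
    (hasseCoeff_map_model_zmod_eq_zero hD hp57 a b hr₄ hr₆)

end Cells

end Literature.NumberTheory.PAdicHodge

end
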